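import Summits.FinalStateConjecture.FinalStateConjecture.Theorems.EIHFluxBalanceInertialRecessionStubHigherOrderC3StepPoint
import Summits.FinalStateConjecture.FinalStateConjecture.Theorems.EIHFluxBalanceInertialRecessionStubHigherOrderRStep

/-!
# Route EIHFluxBalance — `InertialRecession` (E′), line `SketchCleanExcision`, skeleton r13,
# stub `stub_higherOrderSlaving` (EF): the third-order step in the limit

Helper file for the crux `stmt-FinalStateConjecture-17403`
(`Summit.FinalStateConjecture.FinalStateConjecture.Theses.EIHFluxBalance.InertialRecession`, E′),
registered stub `stub_higherOrderSlaving` (orders two and three of frozen-vacuum slaving).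

`higherOrder_c3step`: under the kinematic clauses of the crux antecedent, the coercivity clause
(CB) of hole `i`, the relative Ricci clause (RR) and the decay of all first- and second-order
sizes `E₁ⱼ(t), E₂ⱼ(t) → 0`, for every `ε > 0` eventually in the lab time `t` the third-order size
of hole `i` is slaved: `E₃ᵢ(t) ≤ ε (1 + Σⱼ E₃ⱼ(t))`. The order-three twin of `higherOrder_rstep`
(`…StubHigherOrderRStep`): the per-hole packages (`…StubHigherOrderHolePackage`), the late tube
of hole `i` (`…StubHigherOrderTube`), the jet bounds (`…StubHigherOrderJetBounds`), uniform
Lipschitz data of the derivative of the Ricci jet function near the compact jet box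
(`exists_uniform_lipschitz_near_isCompact`) and the `C³` conjunct of the clause (RR) at a
smallness parameter `ε'` fixed by these constants are fed at every late time into the pointwise
step `higherOrder_c3step_point` (`…StubHigherOrderC3StepPoint`, seat 1 of the route); the
order-three dictionary of the package converts the reduced third-order rate into `E₃ᵢ`.

No definitions, no named facts, no `sorry`.
-/

set_option linter.dupNamespace false
set_option maxSynthPendingDepth 6
set_option synthInstance.maxHeartbeats 200000

noncomputable section

namespace Summit.FinalStateConjecture.FinalStateConjecture.Theorems.SublinearIsFree.Slaving

open scoped Topology ContDiff BigOperators
open Filter Set Function Metric Literature.Geometry.Lorentzian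
  Summit.FinalStateConjecture.FinalStateConjecture.Theorems
open MetricCoord

/-- **Registered one-line carrier form** (`higherOrder_sumThree_EF`): a sum of three-term sums
splits. [folklore] -/
theorem higherOrder_sumThree_EF : ∀ {N : ℕ} (e₁ e₂ e₃ : Fin N → ℝ), ∑ j, (e₃ j + e₂ j + e₁ j) = ∑ j, e₃ j + ∑ j, e₂ j + ∑ j, e₁ j := by
  intro N e₁ e₂ e₃
  rw [Finset.sum_add_distrib, Finset.sum_add_distrib]

section C3Step

variable {N : ℕ} {M a rin : Fin N → ℝ} {Λ : Fin N → ℝ → lorentzGroup} {ξ : Fin N → ℝ → E3} {γ : ℝ}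

set_option maxHeartbeats 12800000 in
/-- **The third-order step in the limit.** See the module docstring: with `E₁ⱼ`, `E₂ⱼ`, `E₃ⱼ`
the sizes of the painted moduli of hole `j` (hypotheses `hE₁`, `hE₂`, `hE₃`), the clause (CB) of
hole `i` (`CBi`), the clause (RR) (`RR`) and `E₁ⱼ, E₂ⱼ → 0` for all `j`, eventually
`E₃ᵢ(t) ≤ ε (1 + Σⱼ E₃ⱼ(t))`. [folklore] -/
theorem higherOrder_c3step
    (H1 : ∀ i, Kerr.IsSubextremal (M i) (a i) ∧ Kerr.rMinus (M i) (a i) < rin i ∧ rin i < Kerr.rPlus (M i) (a i))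
    (Hγ : ∀ i t, |((Λ i t : E4 ≃L[ℝ] E4) (E4.basisVector 0)) 0| ≤ γ)
    (Hsm : ∀ i, ContDiff ℝ ∞ (ξ i) ∧ ContDiff ℝ ∞ (fun t ↦ ((Λ i t : E4 ≃L[ℝ] E4) : E4 →L[ℝ] E4)))
    (Hsep : ∀ i j, i ≠ j → Tendsto (fun t ↦ ‖ξ i t - ξ j t‖) atTop atTop) (i : Fin N)
    (CBi : (∃ c ρin ρout η₀ : ℝ, 0 < c ∧ 0 < η₀ ∧ 0 < ρin ∧ ρin ≤ ρout ∧ (∀ (L : lorentzGroup) (y : E3), |((L : E4 ≃L[ℝ] E4) (E4.basisVector 0)) 0| ≤ γ → ρin ≤ ‖y‖ → 2 * (M i) < Kerr.radius (a i) (poincareInv L 0 (E4.ofTimeSpace 0 y))) ∧ ∀ (L : lorentzGroup) (A : E4 →L[ℝ] E4) (d : E4) (G G' : E4 → E4 →L[ℝ] E4 →L[ℝ] ℝ) (V : Set E4), |((L : E4 ≃L[ℝ] E4) (E4.basisVector 0)) 0| ≤ γ → (∀ u w : E4, Minkowski.bilin (A u) w + Minkowski.bilin u (A w) = 0) → MetricCoord.IsMetricOn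 G V → MetricCoord.IsMetricOn G' V → (∀ y : E3, ρin ≤ ‖y‖ → ‖y‖ ≤ ρout → (E4.ofTimeSpace 0 y) ∈ V ∧ ‖G (E4.ofTimeSpace 0 y) - boostedKerrBilin L 0 (M i) (a i) (E4.ofTimeSpace 0 y)‖ ≤ η₀ ∧ G' (E4.ofTimeSpace 0 y) = G (E4.ofTimeSpace 0 y) ∧ fderiv ℝ G' (E4.ofTimeSpace 0 y) = fderiv ℝ G (E4.ofTimeSpace 0 y) ∧ ∀ v : E4, fderiv ℝ (fderiv ℝ G') (E4.ofTimeSpace 0 y) v = fderiv ℝ (fderiv ℝ G) (E4.ofTimeSpace 0 y) v + (v 0) • (E4.dx 0).smulRight ((fderiv ℝ (Kerr.bilin (M i) (a i)) (poincareInv L 0 (E4.ofTimeSpace 0 y)) (A (poincareInv L 0 (E4.ofTimeSpace 0 y)) + d)).bilinearComp (((L : E4 ≃L[ℝ] E4).symm : E4 →L[ℝ] E4)) (((L : E4 ≃L[ℝ] E4).symm : E4 →L[ℝ] E4)) + (Kerr.bilin (M i) (a i) (poincareInv L 0 (E4.ofTimeSpace 0 y))).bilinearComp (A.comp (((L : E4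 ≃L[ℝ] E4).symm : E4 →L[ℝ] E4))) (((L : E4 ≃L[ℝ] E4).symm : E4 →L[ℝ] E4)) + (Kerr.bilin (M i) (a i) (poincareInv L 0 (E4.ofTimeSpace 0 y))).bilinearComp (((L : E4 ≃L[ℝ] E4).symm : E4 →L[ℝ] E4)) (A.comp (((L : E4 ≃L[ℝ] E4).symm : E4 →L[ℝ] E4))))) → ∃ y : E3, ρin ≤ ‖y‖ ∧ ‖y‖ ≤ ρout ∧ c * (‖A (E4.basisVector 0)‖ + ‖E4.spatial d‖ + ‖(a i) • A (E4.basisVector 3)‖) ≤ ‖MetricCoord.ricAt G' (E4.ofTimeSpace 0 y) - MetricCoord.ricAt G (E4.ofTimeSpace 0 y)‖))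
    (RR : (∀ (i : Fin N) (R r₀ : ℝ), rin i ≤ r₀ → ∀ ε : ℝ, 0 < ε → ∃ T : ℝ, ∀ x : E4, T < x 0 → ‖E4.spatial x - ξ i (x 0)‖ < R → r₀ < Kerr.radius (a i) (poincareInv (Λ i (x 0)) (E4.ofTimeSpace (x 0) (ξ i (x 0))) x) → ∀ l : ℝ, 1 ≤ l → ‖fderiv ℝ (fun z : E4 ↦ Minkowski.bilin + ∑ i, (boostedKerrBilin (Λ i (z 0)) (E4.ofTimeSpace (z 0) (ξ i (z 0))) (M i) (a i) z - Minkowski.bilin)) x‖ ≤ l → ‖fderiv ℝ (fderiv ℝ (fun z : E4 ↦ Minkowski.bilin + ∑ i, (boostedKerrBilin (Λ i (z 0)) (E4.ofTimeSpace (z 0) (ξ i (z 0))) (M i) (a i) z - Minkowski.bilin))) x‖ ≤ l ^ 2 → ‖MetricCoord.ricAt (fun z : E4 ↦ Minkowski.bilin + ∑ i, (boostedKerrBilin (Λ i (z 0)) (E4.ofTimeSpace (z 0) (ξ i (z 0))) (M i) (a i) z - Minkowski.bilin)) x‖ ≤ ε * l ^ 2 ∧ (‖fderiv ℝ (fderiv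 ℝ (fderiv ℝ (fun z : E4 ↦ Minkowski.bilin + ∑ i, (boostedKerrBilin (Λ i (z 0)) (E4.ofTimeSpace (z 0) (ξ i (z 0))) (M i) (a i) z - Minkowski.bilin)))) x‖ ≤ l ^ 3 → ‖fderiv ℝ (MetricCoord.ricAt (fun z : E4 ↦ Minkowski.bilin + ∑ i, (boostedKerrBilin (Λ i (z 0)) (E4.ofTimeSpace (z 0) (ξ i (z 0))) (M i) (a i) z - Minkowski.bilin))) x‖ ≤ ε * l ^ 3)))
    {E₁ E₂ E₃ : Fin N → ℝ → ℝ}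
    (hE₁ : ∀ j t, E₁ j t = ‖deriv (fun s ↦ (Λ j s : E4 ≃L[ℝ] E4) (E4.basisVector 0)) t‖ +
      ‖deriv (ξ j) t - (((Λ j t : E4 ≃L[ℝ] E4) (E4.basisVector 0)) 0)⁻¹ • E4.spatial ((Λ j t : E4 ≃L[ℝ] E4) (E4.basisVector 0))‖ +
      (if a j = 0 then 0 else ‖deriv (fun s ↦ (Λ j s : E4 ≃L[ℝ] E4) (E4.basisVector 3)) t‖))
    (hE₂ : ∀ j t, E₂ j t = ‖iteratedDeriv 2 (fun s ↦ (Λ j s : E4 ≃L[ℝ] E4) (E4.basisVector 0)) t‖ +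
      ‖deriv (fun s ↦ deriv (ξ j) s - (((Λ j s : E4 ≃L[ℝ] E4) (E4.basisVector 0)) 0)⁻¹ •
        E4.spatial ((Λ j s : E4 ≃L[ℝ] E4) (E4.basisVector 0))) t‖ +
      (if a j = 0 then 0 else ‖iteratedDeriv 2 (fun s ↦ (Λ j s : E4 ≃L[ℝ] E4) (E4.basisVector 3)) t‖))
    (hE₃ : ∀ j t, E₃ j t = ‖iteratedDeriv 3 (fun s ↦ (Λ j s : E4 ≃L[ℝ] E4) (E4.basisVector 0)) t‖ +
      ‖iteratedDeriv 2 (fun s ↦ deriv (ξ j) s - (((Λ j s : E4 ≃L[ℝ] E4) (E4.basisVector 0)) 0)⁻¹ •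
        E4.spatial ((Λ j s : E4 ≃L[ℝ] E4) (E4.basisVector 0))) t‖ +
      (if a j = 0 then 0 else ‖iteratedDeriv 3 (fun s ↦ (Λ j s : E4 ≃L[ℝ] E4) (E4.basisVector 3)) t‖))
    (hfirst : ∀ j, Tendsto (E₁ j) atTop (𝓝 0)) (hsecond : ∀ j, Tendsto (E₂ j) atTop (𝓝 0))
    {ε : ℝ} (hε : 0 < ε) :
    ∀ᶠ t in atTop, E₃ i t ≤ ε * (1 + ∑ j, E₃ j t) := by
  obtain ⟨c₀, ρin, ρout, η₀, hc₀, hη₀, hρin, hρio, hshell, hcoer⟩ := CBi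
  have hMi : 0 < M i := (H1 i).1.pos
  have hN0 : (0 : ℝ) ≤ N := Nat.cast_nonneg N
  have hΛs : ∀ j, ContDiff ℝ ∞ (fun t ↦ ((Λ j t : E4 ≃L[ℝ] E4) : E4 →L[ℝ] E4)) := fun j ↦ (Hsm j).2
  have hξs : ∀ j, ContDiff ℝ ∞ (ξ j) := fun j ↦ (Hsm j).1
  -- ### the per-hole packages
  choose Λ' Q hQ1 hΛ's _hpaint hcol hcol3 hγ' hpkg using
    fun j ↦ higherOrder_holePackage (Λ j) (ξ j) (a j) (hΛs j) (hξs j) (Hγ j)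
  have hQ0 : 0 ≤ Q i := zero_le_one.trans (hQ1 i)
  -- ### the tube of hole `i`
  have hrin0 : 0 < rin i := (H1 i).1.rMinus_nonneg.trans_lt (H1 i).2.1
  have hrinM : rin i < 2 * M i := (H1 i).2.2.trans_le (Kerr.rPlus_le_two_mul_self hMi.le (a i))
  obtain ⟨T₀, m, α, hm, _hα, hmetric, hfacts⟩ :=
    higherOrder_tube (M := M) (a := a) Hγ Hsm Hsep i (ρout + 1) hrin0
  -- ### the jet bounds
  obtain ⟨C_J, hC_J, hJB⟩ := higherOrder_jetBounds M a Λ Λ' ξ Q Hsm hΛ's hγ' hQ1 hpkg i ρout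
    (r₁ := 2 * M i) (by positivity)
  -- ### the compact jet box and the Lipschitz data of the derivative of the Ricci jet function
  let R₁ : ℝ := C_J * (1 + 3 * N + 3 * (3 * N)) + 1
  have hR₁ : R₁ = C_J * (1 + 3 * N + 3 * (3 * N)) + 1 := rfl
  let Kj : Set (E4 × (E4 →L[ℝ] E4 →L[ℝ] ℝ) × (E4 →L[ℝ] E4 →L[ℝ] E4 →L[ℝ] ℝ) × (E4 →L[ℝ] E4 →L[ℝ] E4 →L[ℝ] E4 →L[ℝ] ℝ)) := Metric.closedBall (0 : E4) ρout ×ˢ ({A : E4 →L[ℝ] E4 →L[ℝ] ℝ | ‖A‖ ≤ α ∧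
    ∀ v : E4, m * ‖v‖ ≤ ‖A v‖} ×ˢ (Metric.closedBall (0 : E4 →L[ℝ] E4 →L[ℝ] E4 →L[ℝ] ℝ) R₁ ×ˢ
    Metric.closedBall (0 : E4 →L[ℝ] E4 →L[ℝ] E4 →L[ℝ] E4 →L[ℝ] ℝ) R₁))
  haveI i1 : FiniteDimensional ℝ (E4 →L[ℝ] E4 →L[ℝ] ℝ) := inferInstance
  haveI i2 : FiniteDimensional ℝ (E4 →L[ℝ] E4 →L[ℝ] E4 →L[ℝ] ℝ) := inferInstance
  haveI i3 : FiniteDimensional ℝ (E4 →L[ℝ] E4 →L[ℝ] E4 →L[ℝ] E4 →L[ℝ] ℝ) := inferInstance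
  haveI i4 : FiniteDimensional ℝ (E4 × (E4 →L[ℝ] E4 →L[ℝ] ℝ) × (E4 →L[ℝ] E4 →L[ℝ] E4 →L[ℝ] ℝ) × (E4 →L[ℝ] E4 →L[ℝ] E4 →L[ℝ] E4 →L[ℝ] ℝ)) := inferInstance
  haveI : ProperSpace (E4 × (E4 →L[ℝ] E4 →L[ℝ] ℝ) × (E4 →L[ℝ] E4 →L[ℝ] E4 →L[ℝ] ℝ) × (E4 →L[ℝ] E4 →L[ℝ] E4 →L[ℝ] E4 →L[ℝ] ℝ)) := FiniteDimensional.proper_real _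
  have hKjc : IsCompact Kj := (isCompact_closedBall _ _).prod ((isCompact_coerciveBox α m).prod
    ((isCompact_closedBall _ _).prod (isCompact_closedBall _ _)))
  have hΩ := isOpen_ricciJetDomain (E := E4)
  have hKjΩ : Kj ⊆ {j : (E4 × (E4 →L[ℝ] E4 →L[ℝ] ℝ) × (E4 →L[ℝ] E4 →L[ℝ] E4 →L[ℝ] ℝ) × (E4 →L[ℝ] E4 →L[ℝ] E4 →L[ℝ] E4 →L[ℝ] ℝ)) | j.2.1.IsInvertible} :=
    fun j hj ↦ coerciveBox_subset_isInvertible hm hj.2.1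
  have hRJ : ContDiffOn ℝ 1 (fderiv ℝ (ricciJet (E := E4))) {j : (E4 × (E4 →L[ℝ] E4 →L[ℝ] ℝ) × (E4 →L[ℝ] E4 →L[ℝ] E4 →L[ℝ] ℝ) × (E4 →L[ℝ] E4 →L[ℝ] E4 →L[ℝ] E4 →L[ℝ] ℝ)) | j.2.1.IsInvertible} :=
    (contDiffOn_ricciJet.fderiv_of_isOpen hΩ (m := ∞) (by simp)).of_le (by simp)
  obtain ⟨r, hr, L₁, B₁, hL₁, hB₁, hLip₁⟩ := exists_uniform_lipschitz_near_isCompact hΩ hRJ hKjc hKjΩ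
  -- ### the smallness parameter of (RR)
  have hb1 : 1 ≤ R₁ + C_J + 1 := by
    have : 0 ≤ C_J * (1 + 3 * N + 3 * (3 * N)) := by positivity
    linarith
  have hCl0 : 0 < (R₁ + C_J + 1) ^ 3 := by positivity
  let ε' : ℝ := c₀ * ε / (2 * Q i * (R₁ + C_J + 1) ^ 3 + 1)
  have hε' : ε' = c₀ * ε / (2 * Q i * (R₁ + C_J + 1) ^ 3 + 1) := rfl
  have hε'0 : 0 < ε' := by positivity
  have hkey : Q i / c₀ * (ε' * (R₁ + C_J + 1) ^ 3) < ε := by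
    have hQp : 0 < Q i := one_pos.trans_le (hQ1 i)
    have hden : 0 < 2 * Q i * (R₁ + C_J + 1) ^ 3 + 1 := by positivity
    have e : Q i / c₀ * (ε' * (R₁ + C_J + 1) ^ 3) =
        ε * (Q i * (R₁ + C_J + 1) ^ 3) / (2 * Q i * (R₁ + C_J + 1) ^ 3 + 1) := by
      rw [hε']; field_simp
    rw [e, div_lt_iff₀ hden]
    nlinarith [mul_pos hQp hCl0]
  obtain ⟨T₁, hT₁⟩ := RR i (ρout + 1) (rin i) le_rfl ε' hε'0
  -- ### the late-time scalars
  let Df : ℝ → ℝ := fun t ↦ ∑ j ∈ Finset.univ.erase i, (‖ξ i t - ξ j t‖ - ρout)⁻¹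
  let SE₁f : ℝ → ℝ := fun t ↦ ∑ j, E₁ j t
  have hSE₁f : SE₁f = fun t ↦ ∑ j, E₁ j t := rfl
  let SE₂f : ℝ → ℝ := fun t ↦ ∑ j, E₂ j t
  have hSE₂f : SE₂f = fun t ↦ ∑ j, E₂ j t := rfl
  have hD : Tendsto Df atTop (𝓝 0) := by
    have h : ∀ j ∈ Finset.univ.erase i, Tendsto (fun t ↦ (‖ξ i t - ξ j t‖ - ρout)⁻¹) atTop (𝓝 0) := by
      intro j hj
      have hij : i ≠ j := (Finset.ne_of_mem_erase hj).symm
      have h1 : Tendsto (fun t ↦ ‖ξ i t - ξ j t‖ - ρout) atTop atTop := by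
        simpa only [sub_eq_add_neg] using tendsto_atTop_add_const_right atTop (-ρout) (Hsep i j hij)
      exact tendsto_inv_atTop_zero.comp h1
    have h2 := tendsto_finsetSum (Finset.univ.erase i) h
    rwa [Finset.sum_const_zero] at h2
  have hSE1 : Tendsto SE₁f atTop (𝓝 0) := by
    have h2 := tendsto_finsetSum (Finset.univ : Finset (Fin N)) (fun j _ ↦ hfirst j)
    rwa [Finset.sum_const_zero] at h2
  have hSE2 : Tendsto SE₂f atTop (𝓝 0) := by
    have h2 := tendsto_finsetSum (Finset.univ : Finset (Fin N)) (fun j _ ↦ hsecond j)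
    rwa [Finset.sum_const_zero] at h2
  have hW₁ : Tendsto (fun t ↦ E₁ i t + Df t * (SE₂f t + SE₁f t)) atTop (𝓝 (0 + 0 * (0 + 0))) :=
    (hfirst i).add (hD.mul (hSE2.add hSE1))
  have hW₂ : Tendsto (fun t ↦ Df t + 3 * SE₁f t + 3 * (SE₂f t + 2 * SE₁f t)) atTop
      (𝓝 (0 + 3 * 0 + 3 * (0 + 2 * 0))) := (hD.add (hSE1.const_mul 3)).add ((hSE2.add (hSE1.const_mul 2)).const_mul 3)
  have hW₃ : Tendsto (fun t ↦ 1 + (SE₂f t + SE₁f t)) atTop (𝓝 (1 + (0 + 0))) := (hSE2.add hSE1).const_add 1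
  have hW₄ : Tendsto (fun t ↦ E₂ i t + E₁ i t) atTop (𝓝 (0 + 0)) := (hsecond i).add (hfirst i)
  have hA : Tendsto (fun t ↦ Q i / c₀ * (4 * m⁻¹ * C_J * (E₁ i t + Df t * (SE₂f t + SE₁f t)) +
      (L₁ * R₁ + B₁) * (C_J * (Df t + 3 * SE₁f t + 3 * (SE₂f t + 2 * SE₁f t))) +
      ε' * ((R₁ + C_J + 1) ^ 3 * (1 + (SE₂f t + SE₁f t)))) + Q i * (E₂ i t + E₁ i t))
      atTop (𝓝 (Q i / c₀ * (4 * m⁻¹ * C_J * (0 + 0 * (0 + 0)) + (L₁ * R₁ + B₁) * (C_J * (0 + 3 * 0 + 3 * (0 + 2 * 0))) +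
        ε' * ((R₁ + C_J + 1) ^ 3 * (1 + (0 + 0)))) + Q i * (0 + 0))) :=
    ((((hW₁.const_mul (4 * m⁻¹ * C_J)).add ((hW₂.const_mul C_J).const_mul (L₁ * R₁ + B₁))).add
      ((hW₃.const_mul ((R₁ + C_J + 1) ^ 3)).const_mul ε')).const_mul (Q i / c₀)).add (hW₄.const_mul (Q i))
  have hAlim : Q i / c₀ * (4 * m⁻¹ * C_J * (0 + 0 * (0 + 0)) + (L₁ * R₁ + B₁) * (C_J * (0 + 3 * 0 + 3 * (0 + 2 * 0))) +
      ε' * ((R₁ + C_J + 1) ^ 3 * (1 + (0 + 0)))) + Q i * (0 + 0) = Q i / c₀ * (ε' * (R₁ + C_J + 1) ^ 3) := by ring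
  rw [hAlim] at hA
  have hB : Tendsto (fun t ↦ Q i / c₀ * (4 * m⁻¹ * C_J * Df t + ε' * (R₁ + C_J + 1) ^ 3)) atTop
      (𝓝 (Q i / c₀ * (4 * m⁻¹ * C_J * 0 + ε' * (R₁ + C_J + 1) ^ 3))) :=
    ((hD.const_mul (4 * m⁻¹ * C_J)).add_const _).const_mul _
  rw [mul_zero, zero_add] at hB
  -- ### the events
  have ev1 : ∀ᶠ t in atTop, ∀ j, E₁ j t ≤ 1 :=
    eventually_all.2 fun j ↦ (hfirst j).eventually (eventually_le_nhds one_pos)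
  have ev1' : ∀ᶠ t in atTop, ∀ j, E₂ j t ≤ 1 :=
    eventually_all.2 fun j ↦ (hsecond j).eventually (eventually_le_nhds one_pos)
  have ev2 : ∀ᶠ t in atTop, ∀ j, j ≠ i → ρout + max 1 (2 * |a j|) + 1 ≤ ‖ξ i t - ξ j t‖ := by
    refine eventually_all.2 fun j ↦ ?_
    by_cases hji : j = i
    · exact Eventually.of_forall fun t h ↦ absurd hji h
    · exact ((Hsep i j (Ne.symm hji)).eventually (eventually_ge_atTop _)).mono fun t h _ ↦ h
  have ev3 : ∀ᶠ t in atTop, C_J * Df t ≤ η₀ := by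
    have h := hD.const_mul C_J
    rw [mul_zero] at h
    exact h.eventually (eventually_le_nhds hη₀)
  have ev4 : ∀ᶠ t in atTop, C_J * (Df t + 3 * SE₁f t + 3 * (SE₂f t + 2 * SE₁f t)) ≤ r := by
    have h := hW₂.const_mul C_J
    rw [show C_J * (0 + 3 * 0 + 3 * (0 + 2 * 0)) = (0 : ℝ) by ring] at h
    exact h.eventually (eventually_le_nhds hr)
  have ev5 := hA.eventually (eventually_le_nhds hkey)
  have ev6 := hB.eventually (eventually_le_nhds hkey)
  filter_upwards [ev1, ev1', ev2, ev3, ev4, ev5, ev6, eventually_gt_atTop T₀, eventually_gt_atTop T₁]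
    with t hE1t hE2t hsepT hclose hδr hAt hBt ht₀ ht₁
  -- ### sizes at the late time `t`
  have hE₁0 : ∀ j, 0 ≤ E₁ j t := fun j ↦ by rw [hE₁]; positivity
  have hE₂0 : ∀ j, 0 ≤ E₂ j t := fun j ↦ by rw [hE₂]; positivity
  have hE₃0 : ∀ j, 0 ≤ E₃ j t := fun j ↦ by rw [hE₃]; positivity
  have hDterm : ∀ j ∈ Finset.univ.erase i, 1 ≤ ‖ξ i t - ξ j t‖ - ρout := fun j hj ↦ by
    have h := hsepT j (Finset.ne_of_mem_erase hj)
    linarith [le_max_left 1 (2 * |a j|)]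
  have hDt0 : 0 ≤ Df t :=
    Finset.sum_nonneg fun j hj ↦ inv_nonneg.2 (zero_le_one.trans (hDterm j hj))
  have hSE₁0 : 0 ≤ SE₁f t := Finset.sum_nonneg fun j _ ↦ hE₁0 j
  have hSE₂0 : 0 ≤ SE₂f t := Finset.sum_nonneg fun j _ ↦ hE₂0 j
  have hSE₁N : SE₁f t ≤ N := by
    have h := Finset.sum_le_card_nsmul (Finset.univ : Finset (Fin N)) (fun j ↦ E₁ j t) 1 fun j _ ↦ hE1t j
    simpa using h
  have hSE₂N : SE₂f t ≤ N := by
    have h := Finset.sum_le_card_nsmul (Finset.univ : Finset (Fin N)) (fun j ↦ E₂ j t) 1 fun j _ ↦ hE2t j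
    simpa using h
  let S₂ : ℝ := ∑ j, (E₂ j t + 2 * E₁ j t)
  have hS₂ : S₂ = ∑ j, (E₂ j t + 2 * E₁ j t) := rfl
  let S₃ : ℝ := ∑ j, (E₃ j t + E₂ j t + E₁ j t)
  have hS₃ : S₃ = ∑ j, (E₃ j t + E₂ j t + E₁ j t) := rfl
  let SE₃ : ℝ := ∑ j, E₃ j t
  have hSE₃ : SE₃ = ∑ j, E₃ j t := rfl
  have hS₂eq : S₂ = SE₂f t + 2 * SE₁f t := by
    simp only [hS₂, hSE₂f, hSE₁f, Finset.sum_add_distrib, Finset.mul_sum]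
  have hS₃eq : S₃ = SE₃ + SE₂f t + SE₁f t := by
    simp only [hS₃, hSE₃, hSE₂f, hSE₁f]
    exact higherOrder_sumThree_EF (fun j ↦ E₁ j t) (fun j ↦ E₂ j t) (fun j ↦ E₃ j t)
  have hSE₃0 : 0 ≤ SE₃ := Finset.sum_nonneg fun j _ ↦ hE₃0 j
  have hS₂0 : 0 ≤ S₂ := by rw [hS₂eq]; positivity
  have hS₃0 : 0 ≤ S₃ := by rw [hS₃eq]; positivity
  have hS₂N : S₂ ≤ 3 * N := by rw [hS₂eq]; linarith
  have hR₁le : C_J * (1 + 3 * SE₁f t + 3 * S₂) + 1 ≤ R₁ := by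
    rw [hR₁]
    have h1 : C_J * (3 * SE₁f t) ≤ C_J * (3 * N) := mul_le_mul_of_nonneg_left (by linarith) hC_J
    have h2 : C_J * (3 * S₂) ≤ C_J * (3 * (3 * N)) := mul_le_mul_of_nonneg_left (by linarith) hC_J
    nlinarith [h1, h2]
  -- ### the fields at the frozen time `t`
  let Φ : ℝ × E4 → E4 →L[ℝ] E4 →L[ℝ] ℝ := fun q ↦ Minkowski.bilin + ∑ j, (boostedKerrBilin (Λ j q.1)
    (E4.ofTimeSpace q.1 (ξ j q.1)) (M j) (a j) q.2 - Minkowski.bilin)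
  let g₀ : E4 → E4 →L[ℝ] E4 →L[ℝ] ℝ := fun z ↦ Minkowski.bilin + ∑ j, (boostedKerrBilin (Λ j (z 0))
    (E4.ofTimeSpace (z 0) (ξ j (z 0))) (M j) (a j) z - Minkowski.bilin)
  let G₀ : E4 → E4 →L[ℝ] E4 →L[ℝ] ℝ := fun z ↦ Φ (t, z)
  let P₁ : E4 → E4 →L[ℝ] E4 →L[ℝ] ℝ := fun z ↦ deriv (fun s ↦ Φ (s, z)) t
  let P₂ : E4 → E4 →L[ℝ] E4 →L[ℝ] ℝ := fun z ↦ iteratedDeriv 2 (fun s ↦ Φ (s, z)) t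
  let P₃ : E4 → E4 →L[ℝ] E4 →L[ℝ] ℝ := fun z ↦ iteratedDeriv 3 (fun s ↦ Φ (s, z)) t
  let Us : Set E4 := {z : E4 | ∀ j, 0 < Kerr.radius (a j) (poincareInv (Λ j t) (E4.ofTimeSpace t (ξ j t)) z)}
  obtain ⟨hUo, hΦc⟩ := higherOrder_contDiffOn_ansatzField N M a Λ ξ hΛs hξs
  obtain ⟨hUso, -, -, -, hP₃c⟩ := higherOrder_contDiffOn_sliceFields hUo hΦc t
  have hUso' : IsOpen Us := hUso
  have hP₃c' : ContDiffOn ℝ ∞ P₃ Us := hP₃c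
  have hP₃s : ∀ z ∈ Us, ∀ u v : E4, P₃ z u v = P₃ z v u :=
    fun z hz u v ↦ higherOrder_variation_symm N M a Λ ξ hΛs hξs hz 3 u v
  have hslice : ∀ x ∈ Us, x 0 = t → g₀ x = G₀ x ∧
      (∀ v, fderiv ℝ g₀ x v = fderiv ℝ G₀ x v + (v 0) • P₁ x) ∧
      (∀ v w, fderiv ℝ (fderiv ℝ g₀) x v w = fderiv ℝ (fderiv ℝ G₀) x v w +
        (v 0) • fderiv ℝ P₁ x w + (w 0) • fderiv ℝ P₁ x v + (v 0 * w 0) • P₂ x) ∧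
      (∀ y v w, fderiv ℝ (fderiv ℝ (fderiv ℝ g₀)) x y v w = fderiv ℝ (fderiv ℝ (fderiv ℝ G₀)) x y v w +
        ((v 0) • fderiv ℝ (fderiv ℝ P₁) x y w + (w 0) • fderiv ℝ (fderiv ℝ P₁) x y v +
          (y 0) • fderiv ℝ (fderiv ℝ P₁) x v w) +
        ((v 0 * w 0) • fderiv ℝ P₂ x y + (y 0 * w 0) • fderiv ℝ P₂ x v + (y 0 * v 0) • fderiv ℝ P₂ x w) +
        (y 0 * v 0 * w 0) • P₃ x) := by
    intro x hx hx0
    have h := higherOrder_sliceModel N M a Λ ξ hΛs hξs hx0 hx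
    exact ⟨h.2.1, h.2.2.1, h.2.2.2.1, h.2.2.2.2⟩
  -- ### the representative frame of hole `i` at `t`
  have hLcol : ∀ x : E4, Kerr.radius (a i) (poincareInv (Λ i t) (E4.ofTimeSpace t (ξ i t)) x) =
      Kerr.radius (a i) (poincareInv (Λ' i t) (E4.ofTimeSpace t (ξ i t)) x) := by
    intro x
    refine higherOrder_radius_poincareInv_eq_of_columns (hcol i t).symm ?_ _ x
    rcases eq_or_ne (a i) 0 with h | h
    · exact Or.inl h
    · exact Or.inr (hcol3 i h t).symm
  let Fi : ℝ → E4 →L[ℝ] E4 := fun s ↦ ((Λ' i s : E4 ≃L[ℝ] E4) : E4 →L[ℝ] E4)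
  let Si : ℝ → E4 →L[ℝ] E4 := fun s ↦ (((Λ' i s : E4 ≃L[ℝ] E4).symm : E4 ≃L[ℝ] E4) : E4 →L[ℝ] E4)
  let Ai : ℝ → E4 →L[ℝ] E4 := fun s ↦ (deriv Si s).comp (Fi s)
  let cci : ℝ → E4 := fun s ↦ E4.ofTimeSpace s (ξ i s) -
    ((s - t) * (((Λ i t : E4 ≃L[ℝ] E4) (E4.basisVector 0)) 0)⁻¹) • (Λ i s : E4 ≃L[ℝ] E4) (E4.basisVector 0)
  have hbr := higherOrder_bodyRate_identities (Λ' i) (hΛ's i) t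
  obtain ⟨-, -, -, -, -, hA''s, -⟩ := hbr
  have hA''s' : ∀ v w : E4, Minkowski.bilin (iteratedDeriv 2 Ai t v) w +
      Minkowski.bilin v (iteratedDeriv 2 Ai t w) = 0 := hA''s
  -- ### the dictionary of the package of hole `i`
  have hP := hpkg i t
  obtain ⟨-, -, -, -, -, -, -, -, -, hdict⟩ := hP
  have hdict' : E₁ i t ≤ 1 → E₂ i t ≤ 1 → E₃ i t ≤ Q i * ((‖iteratedDeriv 2 Ai t (E4.basisVector 0)‖ +
      ‖E4.spatial (Si t (-(iteratedDeriv 3 cci t)))‖ + ‖a i • iteratedDeriv 2 Ai t (E4.basisVector 3)‖) +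
      E₂ i t + E₁ i t) := by
    rw [hE₁, hE₂, hE₃]; exact hdict
  -- ### the tube facts in the form of the pointwise step
  have hfacts' : ∀ z : E4, T₀ < z 0 → ‖E4.spatial z - ξ i (z 0)‖ ≤ ρout + 1 →
      rin i ≤ Kerr.radius (a i) (poincareInv (Λ i (z 0)) (E4.ofTimeSpace (z 0) (ξ i (z 0))) z) →
      (z 0 = t → z ∈ Us) ∧ (∀ v : E4, m * ‖v‖ ≤ ‖g₀ z v‖) ∧ ‖g₀ z‖ ≤ α := by
    intro z hz1 hz2 hz3
    obtain ⟨hradz, hcoz, hαz⟩ := hfacts z hz1 hz2 hz3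
    refine ⟨fun hz0 ↦ ?_, hcoz, hαz⟩
    show ∀ j, 0 < Kerr.radius (a j) (poincareInv (Λ j t) (E4.ofTimeSpace t (ξ j t)) z)
    intro j
    have h := hradz j
    rw [hz0] at h
    exact h
  have hrrc : ∀ x : E4, T₁ < x 0 → ‖E4.spatial x - ξ i (x 0)‖ < ρout + 1 →
      rin i < Kerr.radius (a i) (poincareInv (Λ i (x 0)) (E4.ofTimeSpace (x 0) (ξ i (x 0))) x) →
      ∀ l : ℝ, 1 ≤ l → ‖fderiv ℝ g₀ x‖ ≤ l → ‖fderiv ℝ (fderiv ℝ g₀) x‖ ≤ l ^ 2 →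
      ‖fderiv ℝ (fderiv ℝ (fderiv ℝ g₀)) x‖ ≤ l ^ 3 → ‖fderiv ℝ (ricAt g₀) x‖ ≤ ε' * l ^ 3 :=
    fun x h1 h2 h3 l hl hD1 hD2 hD3 ↦ (hT₁ x h1 h2 h3 l hl hD1 hD2).2 hD3
  -- ### the jet bounds in scalar form
  let W : E4 → E4 →L[ℝ] E4 →L[ℝ] ℝ := fun x ↦ ((fderiv ℝ (Kerr.bilin (M i) (a i)) (poincareInv (Λ' i t) 0 (x - E4.ofTimeSpace t (ξ i t))) (iteratedDeriv 2 Ai t (poincareInv (Λ' i t) 0 (x - E4.ofTimeSpace t (ξ i t))) + Si t (-(iteratedDeriv 3 cci t)))).bilinearComp ((((Λ' i t) : E4 ≃L[ℝ] E4).symm : E4 →L[ℝ] E4)) ((((Λ' i t) : E4 ≃L[ℝ] E4).symm : E4 →L[ℝ] E4)) + (Kerr.bilin (M i) (a i) (poincareInv (Λ' i t) 0 (x - E4.ofTimeSpace t (ξ i t)))).bilinearComp ((iteratedDeriv 2 Ai t).comp ((((Λ' i t) : E4 ≃L[ℝ] E4).symm : E4 →L[ℝ] E4))) ((((Λ' i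 t) : E4 ≃L[ℝ] E4).symm : E4 →L[ℝ] E4)) + (Kerr.bilin (M i) (a i) (poincareInv (Λ' i t) 0 (x - E4.ofTimeSpace t (ξ i t)))).bilinearComp ((((Λ' i t) : E4 ≃L[ℝ] E4).symm : E4 →L[ℝ] E4)) ((iteratedDeriv 2 Ai t).comp ((((Λ' i t) : E4 ≃L[ℝ] E4).symm : E4 →L[ℝ] E4))))
  have hJ : ∀ x ∈ Us, x 0 = t → ‖x - E4.ofTimeSpace t (ξ i t)‖ ≤ ρout →
      2 * M i ≤ Kerr.radius (a i) (poincareInv (Λ' i t) (E4.ofTimeSpace t (ξ i t)) x) →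
      (‖fderiv ℝ G₀ x‖ ≤ C_J ∧ ‖fderiv ℝ (fderiv ℝ G₀) x‖ ≤ C_J ∧ ‖fderiv ℝ (fderiv ℝ (fderiv ℝ G₀)) x‖ ≤ C_J) ∧
      (‖G₀ x - boostedKerrBilin (Λ' i t) (E4.ofTimeSpace t (ξ i t)) (M i) (a i) x‖ ≤ C_J * Df t ∧
        ‖fderiv ℝ G₀ x - fderiv ℝ (boostedKerrBilin (Λ' i t) (E4.ofTimeSpace t (ξ i t)) (M i) (a i)) x‖ ≤ C_J * Df t ∧
        ‖fderiv ℝ (fderiv ℝ G₀) x - fderiv ℝ (fderiv ℝ (boostedKerrBilin (Λ' i t) (E4.ofTimeSpace t (ξ i t)) (M i) (a i))) x‖ ≤ C_J * Df t ∧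
        ‖fderiv ℝ (fderiv ℝ (fderiv ℝ G₀)) x - fderiv ℝ (fderiv ℝ (fderiv ℝ (boostedKerrBilin (Λ' i t) (E4.ofTimeSpace t (ξ i t)) (M i) (a i)))) x‖ ≤ C_J * Df t) ∧
      (‖P₁ x‖ ≤ C_J * SE₁f t ∧ ‖fderiv ℝ P₁ x‖ ≤ C_J * SE₁f t ∧ ‖fderiv ℝ (fderiv ℝ P₁) x‖ ≤ C_J * SE₁f t) ∧
      (‖P₂ x‖ ≤ C_J * S₂ ∧ ‖fderiv ℝ P₂ x‖ ≤ C_J * S₂) ∧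
      (‖P₃ x - W x‖ ≤ C_J * (E₁ i t + Df t * S₃) ∧ ‖P₃ x‖ ≤ C_J * S₃) := by
    intro x hx hx0 hxc h2M
    have hdist : ∀ j, j ≠ i → ‖ξ i t - ξ j t‖ - ρout ≤ ‖x - E4.ofTimeSpace t (ξ j t)‖ :=
      fun j _ ↦ higherOrder_invDist_EF (ξ i t) (ξ j t) hx0 hxc
    have hfar : ∀ j, j ≠ i → 1 ≤ ‖x - E4.ofTimeSpace t (ξ j t)‖ ∧ 2 * |a j| ≤ ‖x - E4.ofTimeSpace t (ξ j t)‖ := by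
      intro j hj
      have h := hsepT j hj
      have hd := hdist j hj
      exact ⟨by linarith [le_max_left 1 (2 * |a j|)], by linarith [le_max_right 1 (2 * |a j|)]⟩
    have hinv : ∀ j ∈ Finset.univ.erase i, ‖x - E4.ofTimeSpace t (ξ j t)‖⁻¹ ≤ (‖ξ i t - ξ j t‖ - ρout)⁻¹ :=
      fun j hj ↦ inv_anti₀ (zero_lt_one.trans_le (hDterm j hj)) (hdist j (Finset.ne_of_mem_erase hj))
    have hinvD : ∀ j ∈ Finset.univ.erase i, ‖x - E4.ofTimeSpace t (ξ j t)‖⁻¹ ≤ Df t := fun j hj ↦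
      (hinv j hj).trans (Finset.single_le_sum (f := fun j ↦ (‖ξ i t - ξ j t‖ - ρout)⁻¹)
        (fun j hj ↦ inv_nonneg.2 (zero_le_one.trans (hDterm j hj))) hj)
    have hsumD : C_J * ∑ j ∈ Finset.univ.erase i, ‖x - E4.ofTimeSpace t (ξ j t)‖⁻¹ ≤ C_J * Df t :=
      mul_le_mul_of_nonneg_left (Finset.sum_le_sum hinv) hC_J
    have hE1x : ∀ j, ‖deriv (fun s ↦ (Λ j s : E4 ≃L[ℝ] E4) (E4.basisVector 0)) t‖ +
        ‖deriv (ξ j) t - (((Λ j t : E4 ≃L[ℝ] E4) (E4.basisVector 0)) 0)⁻¹ • E4.spatial ((Λ j t : E4 ≃L[ℝ] E4) (E4.basisVector 0))‖ +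
        (if a j = 0 then 0 else ‖deriv (fun s ↦ (Λ j s : E4 ≃L[ℝ] E4) (E4.basisVector 3)) t‖) ≤ 1 :=
      fun j ↦ by rw [← hE₁]; exact hE1t j
    have hE2x : ∀ j, ‖iteratedDeriv 2 (fun s ↦ (Λ j s : E4 ≃L[ℝ] E4) (E4.basisVector 0)) t‖ +
        ‖deriv (fun s ↦ deriv (ξ j) s - (((Λ j s : E4 ≃L[ℝ] E4) (E4.basisVector 0)) 0)⁻¹ •
          E4.spatial ((Λ j s : E4 ≃L[ℝ] E4) (E4.basisVector 0))) t‖ +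
        (if a j = 0 then 0 else ‖iteratedDeriv 2 (fun s ↦ (Λ j s : E4 ≃L[ℝ] E4) (E4.basisVector 3)) t‖) ≤ 1 :=
      fun j ↦ by rw [← hE₂]; exact hE2t j
    have hJx := hJB t x hx0 hx hxc h2M hfar
    obtain ⟨⟨hB1, hB2, hB3⟩, ⟨hGK0, hGK1, hGK2, hGK3⟩, ⟨hP1a, hP1b, hP1c⟩, ⟨-, hP2a, hP2b⟩, hP3⟩ := hJx hE1x
    obtain ⟨hW3, hP3a⟩ := hP3 hE2x
    have eS₁ : (∑ j, (‖deriv (fun s ↦ (Λ j s : E4 ≃L[ℝ] E4) (E4.basisVector 0)) t‖ +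
        ‖deriv (ξ j) t - (((Λ j t : E4 ≃L[ℝ] E4) (E4.basisVector 0)) 0)⁻¹ • E4.spatial ((Λ j t : E4 ≃L[ℝ] E4) (E4.basisVector 0))‖ +
        (if a j = 0 then 0 else ‖deriv (fun s ↦ (Λ j s : E4 ≃L[ℝ] E4) (E4.basisVector 3)) t‖))) = SE₁f t := by
      simp only [hSE₁f, hE₁]
    have hP1a' : ‖P₁ x‖ ≤ C_J * SE₁f t := by rw [← eS₁]; exact hP1a
    have hP1b' : ‖fderiv ℝ P₁ x‖ ≤ C_J * SE₁f t := by rw [← eS₁]; exact hP1b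
    have hP1c' : ‖fderiv ℝ (fderiv ℝ P₁) x‖ ≤ C_J * SE₁f t := by rw [← eS₁]; exact hP1c
    have hP2a' : ‖P₂ x‖ ≤ C_J * S₂ := by simp only [hS₂, hE₁, hE₂]; exact hP2a
    have hP2b' : ‖fderiv ℝ P₂ x‖ ≤ C_J * S₂ := by simp only [hS₂, hE₁, hE₂]; exact hP2b
    have hP3a' : ‖P₃ x‖ ≤ C_J * S₃ := by simp only [hS₃, hE₁, hE₂, hE₃]; exact hP3a
    have hW3' : ‖P₃ x - W x‖ ≤ C_J * (E₁ i t + ∑ j ∈ Finset.univ.erase i,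
        ‖x - E4.ofTimeSpace t (ξ j t)‖⁻¹ * (E₃ j t + E₂ j t + E₁ j t)) := by
      simp only [hE₁, hE₂, hE₃]; exact hW3
    have hWerr : E₁ i t + ∑ j ∈ Finset.univ.erase i, ‖x - E4.ofTimeSpace t (ξ j t)‖⁻¹ * (E₃ j t + E₂ j t + E₁ j t) ≤
        E₁ i t + Df t * S₃ := by
      have h1 : ∑ j ∈ Finset.univ.erase i, ‖x - E4.ofTimeSpace t (ξ j t)‖⁻¹ * (E₃ j t + E₂ j t + E₁ j t) ≤
          Df t * ∑ j ∈ Finset.univ.erase i, (E₃ j t + E₂ j t + E₁ j t) :=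
        higherOrder_sum_coeff_le _ hinvD fun j _ ↦ by linarith [hE₁0 j, hE₂0 j, hE₃0 j]
      have h2 : ∑ j ∈ Finset.univ.erase i, (E₃ j t + E₂ j t + E₁ j t) ≤ S₃ :=
        Finset.sum_le_sum_of_subset_of_nonneg (Finset.erase_subset _ _) fun j _ _ ↦ by
          linarith [hE₁0 j, hE₂0 j, hE₃0 j]
      linarith [mul_le_mul_of_nonneg_left h2 hDt0]
    exact ⟨⟨hB1, hB2, hB3⟩, ⟨hGK0.trans hsumD, hGK1.trans hsumD, hGK2.trans hsumD, hGK3.trans hsumD⟩,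
      ⟨hP1a', hP1b', hP1c'⟩, ⟨hP2a', hP2b'⟩, ⟨hW3'.trans (mul_le_mul_of_nonneg_left hWerr hC_J), hP3a'⟩⟩
  -- ### the pointwise step
  have hδr' : C_J * (Df t + 3 * SE₁f t + 3 * S₂) ≤ r := by rw [hS₂eq]; exact hδr
  have hstep := higherOrder_c3step_point (Mᵢ := M i) (aᵢ := a i) (γ := γ) hMi hshell hcoer
    (g₀ := g₀) (G₀ := G₀) (P₁ := P₁) (P₂ := P₂) (P₃ := P₃) (Us := Us) (t := t) hUso' hP₃c' hP₃s hslice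
    (Λ i) (ξ i) (Λ' i t) (hγ' i t) hLcol (A'' := iteratedDeriv 2 Ai t) hA''s' (Si t (-(iteratedDeriv 3 cci t)))
    hm hrinM hmetric hfacts' hC_J hDt0 hSE₁0 hS₂0 hS₃0 hJ hR₁le hL₁ hLip₁ hrrc ht₀ ht₁ hclose hδr'
  -- ### conclusion
  have h1 := hdict' (hE1t i) (hE2t i)
  have hred : ‖iteratedDeriv 2 Ai t (E4.basisVector 0)‖ + ‖E4.spatial (Si t (-(iteratedDeriv 3 cci t)))‖ +
      ‖a i • iteratedDeriv 2 Ai t (E4.basisVector 3)‖ ≤ (4 * m⁻¹ * C_J * (E₁ i t + Df t * S₃) +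
      (L₁ * R₁ + B₁) * (C_J * (Df t + 3 * SE₁f t + 3 * S₂)) + ε' * ((R₁ + C_J + 1) ^ 3 * (1 + S₃))) / c₀ := by
    rw [le_div_iff₀ hc₀, mul_comm]; exact hstep
  have h2 : E₃ i t ≤ Q i * ((4 * m⁻¹ * C_J * (E₁ i t + Df t * S₃) +
      (L₁ * R₁ + B₁) * (C_J * (Df t + 3 * SE₁f t + 3 * S₂)) + ε' * ((R₁ + C_J + 1) ^ 3 * (1 + S₃))) / c₀ +
      E₂ i t + E₁ i t) :=
    h1.trans (mul_le_mul_of_nonneg_left (by linarith) hQ0)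
  have h3 : Q i * ((4 * m⁻¹ * C_J * (E₁ i t + Df t * S₃) +
      (L₁ * R₁ + B₁) * (C_J * (Df t + 3 * SE₁f t + 3 * S₂)) + ε' * ((R₁ + C_J + 1) ^ 3 * (1 + S₃))) / c₀ +
      E₂ i t + E₁ i t) =
      (Q i / c₀ * (4 * m⁻¹ * C_J * (E₁ i t + Df t * (SE₂f t + SE₁f t)) +
        (L₁ * R₁ + B₁) * (C_J * (Df t + 3 * SE₁f t + 3 * (SE₂f t + 2 * SE₁f t))) +
        ε' * ((R₁ + C_J + 1) ^ 3 * (1 + (SE₂f t + SE₁f t)))) + Q i * (E₂ i t + E₁ i t)) +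
      (Q i / c₀ * (4 * m⁻¹ * C_J * Df t + ε' * (R₁ + C_J + 1) ^ 3)) * SE₃ := by
    rw [hS₃eq, hS₂eq]; ring
  have h4 : (Q i / c₀ * (4 * m⁻¹ * C_J * Df t + ε' * (R₁ + C_J + 1) ^ 3)) * SE₃ ≤ ε * SE₃ :=
    mul_le_mul_of_nonneg_right hBt hSE₃0
  have h5 : E₃ i t ≤ ε + ε * SE₃ := by linarith [h2, h3, h4, hAt]
  linarith [h5]

end C3Step

end Summit.FinalStateConjecture.FinalStateConjecture.Theorems.SublinearIsFree.Slaving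

end
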